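import Mathlib
import Literature.Combinatorics.StablePolynomials.HalfPlaneApolarity
import Summits.ValiantsHypothesis.ValiantsHypothesis.Theorems.GrenetZeonTwoDimCoefficientsScalingAlgebra
import Summits.ValiantsHypothesis.ValiantsHypothesis.Theorems.GrenetZeonTwoDimCoefficientsScalingCompanionTwoTop

/-!
# Crux `GrenetZeon.TwoDimCoefficients` (stmt-ValiantsHypothesis-8062), stub `stub_dualUnipotent`:
# scaling-closure — on index-`n` pencils THE SHADOW IS A DETERMINANT: `Φ = c·det(1 + c⁻¹·P^top)`

The scaling-closure shadow of a unipotent dual representation (`det A = c ≠ 0`, `per_n = α·c + β·tr(adj A·B)`) is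
`Φ = Σ_k [D_k]_{kn}`, `D_k = [X^k] det(X·B + A)`.  When the numerator `P = adj A·B` has degree `≤ n` — every index-`n`
normal form (✓ `totalDegree_adjugate_le_of_index`) — the companions are the TOP SYMBOLS of the coefficients of
`det(1 + X·c⁻¹P)`, and top symbols multiply:

* `coeff_mul_top`, `coeff_prod_top` — graded top parts of products of polynomials in `X` over `ℂ[z]`;
* `coeff_charmatrix_entry`, ★ `homogeneousComponent_coeff_charpolyRev_top` — `[ [X^k] det(1 − X·Q) ]_{kn} = [X^k] det(1 − X·Q^top)`
  for a matrix `Q` of polynomials of degree `≤ n` with top part `Q^top`;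
* ★ `topCompanion_eq` — `[D_k]_{kn} = c·[X^k] det(1 + X·c⁻¹P^top)` for every `k`;
* ★ `sum_topCompanions_eq_det` — `Σ_{k ≤ m} [D_k]_{kn} = c·det(1 + c⁻¹·P^top)`: the shadow of ✓ `exists_shadowFamily`
  (`c + β⁻¹per_n + Σ_{2≤k≤m}[D_k]_{kn}`, cf. ✓ `trace_top_eq` for the `k = 1` term) is the honest `m × m` determinant
  `c·det(1_m + Y)` of the degree-`n` matrix `Y = c⁻¹P^top` (`tr Y = (βc)⁻¹per_n`; for `A = A₀(1 − N)`, `Nⁿ = 0`: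
  `Y = (−N)^{n−1}·A₀⁻¹B₁` up to the constant), so the residual R3′ of the factor programme on index-`n` pencils reads:
  control the irreducible factors of `det(1_m + Y(z))`.

HONEST FRAMING: identities; the stub `DualUnipotentBound`, the crux and `VP ≠ VNP` remain open.

References: folklore.
-/

-- single-conjunct layout `Summits/ValiantsHypothesis/ValiantsHypothesis`: the duplicated namespace
-- component is mandated by the tree.
set_option linter.dupNamespace false
set_option autoImplicit false

noncomputable section

namespace Summit.ValiantsHypothesis.ValiantsHypothesis.Theorems.GrenetZeonTwoDimCoefficients.ScalingClosure

open MvPolynomial Matrix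
open Literature.Computability.AlgebraicComplexity
open Summit.ValiantsHypothesis.ValiantsHypothesis.Cruxes.TwoDimCoefficients.DimTwoCases

/-! ### Top symbols of polynomials in `X` over `ℂ[z]` -/

section TopSymbol

variable {σ : Type*} [DecidableEq σ]

/-- **Top symbols multiply.**  If `deg [X^j]F ≤ j·n`, `deg [X^j]G ≤ j·n` and `Fᵗ`, `Gᵗ` collect the degree-`j·n`
components of the coefficients, then the same holds for `F·G` with top symbol `Fᵗ·Gᵗ`. [folklore] -/
theorem coeff_mul_top (n : ℕ) (F G Ft Gt : Polynomial (MvPolynomial σ ℂ))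
    (hF : ∀ j, (F.coeff j).totalDegree ≤ j * n) (hG : ∀ j, (G.coeff j).totalDegree ≤ j * n)
    (hFt : ∀ j, homogeneousComponent (j * n) (F.coeff j) = Ft.coeff j)
    (hGt : ∀ j, homogeneousComponent (j * n) (G.coeff j) = Gt.coeff j) :
    (∀ j, ((F * G).coeff j).totalDegree ≤ j * n) ∧
      ∀ j, homogeneousComponent (j * n) ((F * G).coeff j) = (Ft * Gt).coeff j := by
  refine ⟨fun j => ?_, fun j => ?_⟩
  · rw [Polynomial.coeff_mul]
    refine (totalDegree_finsetSum _ _).trans (Finset.sup_le fun x hx => ?_)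
    have hx' : x.1 + x.2 = j := Finset.HasAntidiagonal.mem_antidiagonal.mp hx
    refine (totalDegree_mul _ _).trans ?_
    calc (F.coeff x.1).totalDegree + (G.coeff x.2).totalDegree ≤ x.1 * n + x.2 * n := Nat.add_le_add (hF _) (hG _)
      _ = j * n := by rw [← Nat.add_mul, hx']
  · rw [Polynomial.coeff_mul, Polynomial.coeff_mul, map_sum]
    refine Finset.sum_congr rfl fun x hx => ?_
    have hx' : x.1 + x.2 = j := Finset.HasAntidiagonal.mem_antidiagonal.mp hx
    rw [show j * n = x.1 * n + x.2 * n by rw [← Nat.add_mul, hx'],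
      Literature.Combinatorics.StablePolynomials.homogeneousComponent_mul_of_totalDegree_le (hF x.1) (hG x.2),
      hFt, hGt]

/-- **Top symbols of finite products.** [folklore] -/
theorem coeff_prod_top (n : ℕ) {ι : Type*} (s : Finset ι) (F Ft : ι → Polynomial (MvPolynomial σ ℂ))
    (hF : ∀ i ∈ s, ∀ j, ((F i).coeff j).totalDegree ≤ j * n)
    (hFt : ∀ i ∈ s, ∀ j, homogeneousComponent (j * n) ((F i).coeff j) = (Ft i).coeff j) :
    (∀ j, ((∏ i ∈ s, F i).coeff j).totalDegree ≤ j * n) ∧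
      ∀ j, homogeneousComponent (j * n) ((∏ i ∈ s, F i).coeff j) = (∏ i ∈ s, Ft i).coeff j := by
  classical
  induction s using Finset.induction_on with
  | empty =>
    refine ⟨fun j => ?_, fun j => ?_⟩
    · rw [Finset.prod_empty, Polynomial.coeff_one]
      split_ifs
      · exact (totalDegree_one).le.trans (Nat.zero_le _)
      · exact (totalDegree_zero).le.trans (Nat.zero_le _)
    · rw [Finset.prod_empty, Finset.prod_empty, Polynomial.coeff_one]
      split_ifs with h
      · subst h
        rw [zero_mul, homogeneousComponent_zero, coeff_one, if_pos rfl, map_one]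
      · exact map_zero _
  | insert a s ha ih =>
    obtain ⟨ih1, ih2⟩ := ih (fun i hi => hF i (Finset.mem_insert_of_mem hi))
      (fun i hi => hFt i (Finset.mem_insert_of_mem hi))
    rw [Finset.prod_insert ha, Finset.prod_insert ha]
    exact coeff_mul_top n (F a) _ (Ft a) _ (hF a (Finset.mem_insert_self a s))  ih1
      (hFt a (Finset.mem_insert_self a s)) ih2

variable {ι : Type*} [Fintype ι] [DecidableEq ι]

omit [DecidableEq σ] [Fintype ι] in
/-- Coefficients of the entries of `1 − X·Q`. [folklore] -/
theorem coeff_charmatrix_entry (Q : Matrix ι ι (MvPolynomial σ ℂ)) (a b : ι) (j : ℕ) :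
    (((1 : Matrix ι ι (Polynomial (MvPolynomial σ ℂ))) -
        (Polynomial.X : Polynomial (MvPolynomial σ ℂ)) • Q.map Polynomial.C) a b).coeff j =
      (if j = 0 then (1 : Matrix ι ι (MvPolynomial σ ℂ)) a b else 0) - (if j = 1 then Q a b else 0) := by
  rw [Matrix.sub_apply, Matrix.smul_apply, Matrix.map_apply, smul_eq_mul, mul_comm,
    ← pow_one (Polynomial.X : Polynomial (MvPolynomial σ ℂ)), Polynomial.coeff_sub, Polynomial.coeff_C_mul_X_pow,
    Matrix.one_apply, Matrix.one_apply]
  congr 1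
  by_cases h : a = b
  · rw [if_pos h, if_pos h, Polynomial.coeff_one]
  · rw [if_neg h, if_neg h, Polynomial.coeff_zero]
    split_ifs <;> rfl

/-- ★ **Top symbol of the coefficients of `det(1 − X·Q)`.**  If every entry of `Q` has degree `≤ n` and `Q^top` is the
matrix of degree-`n` components, then `[ [X^k] det(1 − X·Q) ]_{k·n} = [X^k] det(1 − X·Q^top)`. [folklore] -/
theorem homogeneousComponent_coeff_charpolyRev_top (n : ℕ) (Q Qt : Matrix ι ι (MvPolynomial σ ℂ))
    (hQ : ∀ i j, (Q i j).totalDegree ≤ n) (hQt : ∀ i j, Qt i j = homogeneousComponent n (Q i j)) (k : ℕ) :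
    homogeneousComponent (k * n) ((Q.charpolyRev).coeff k) = (Qt.charpolyRev).coeff k := by
  rw [Matrix.charpolyRev, Matrix.charpolyRev, det_apply', det_apply', Polynomial.finsetSum_coeff,
    Polynomial.finsetSum_coeff, map_sum]
  refine Finset.sum_congr rfl fun τ _ => ?_
  rw [← map_intCast (Polynomial.C : MvPolynomial σ ℂ →+* Polynomial (MvPolynomial σ ℂ)), Polynomial.coeff_C_mul,
    Polynomial.coeff_C_mul, ← map_intCast (MvPolynomial.C : ℂ →+* MvPolynomial σ ℂ), homogeneousComponent_C_mul]
  congr 1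
  refine (coeff_prod_top n Finset.univ
    (fun i => ((1 : Matrix ι ι (Polynomial (MvPolynomial σ ℂ))) -
      (Polynomial.X : Polynomial (MvPolynomial σ ℂ)) • Q.map Polynomial.C) (τ i) i)
    (fun i => ((1 : Matrix ι ι (Polynomial (MvPolynomial σ ℂ))) -
      (Polynomial.X : Polynomial (MvPolynomial σ ℂ)) • Qt.map Polynomial.C) (τ i) i)
    (fun i _ j => ?_) (fun i _ j => ?_)).2 k
  · rw [coeff_charmatrix_entry]
    refine (totalDegree_sub _ _).trans (max_le ?_ ?_)
    · split_ifs
      · rw [Matrix.one_apply]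
        split_ifs
        · exact (totalDegree_one).le.trans (Nat.zero_le _)
        · exact (totalDegree_zero).le.trans (Nat.zero_le _)
      · exact (totalDegree_zero).le.trans (Nat.zero_le _)
    · split_ifs with h1
      · subst h1
        exact (hQ _ _).trans (by omega)
      · exact (totalDegree_zero).le.trans (Nat.zero_le _)
  · rw [coeff_charmatrix_entry, coeff_charmatrix_entry, map_sub]
    congr 1
    · split_ifs with h0
      · subst h0
        rw [zero_mul, homogeneousComponent_zero, Matrix.one_apply]
        split_ifs
        · rw [coeff_one, if_pos rfl, map_one]
        · rw [coeff_zero, map_zero]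
      · exact map_zero _
    · split_ifs with h1
      · subst h1
        rw [one_mul, hQt]
      · exact map_zero _

end TopSymbol

/-! ### The companions and the shadow of a pencil with numerator of degree `≤ n` -/

section Shadow

variable {n m : ℕ}

/-- ★ **Every companion is a top symbol**: `det A = c ≠ 0`, `deg(adj A·B) ≤ n`, `P^top` the degree-`n` part of
`adj A·B` ⟹ `[D_k]_{k·n} = c·[X^k] det(1 + X·c⁻¹P^top)` for all `k`. [folklore] -/
theorem topCompanion_eq (A B : AffMat n m) (c : ℂ) (hc : c ≠ 0) (hdet : A.det = MvPolynomial.C c)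
    (hP : ∀ i j, ((A.adjugate * B) i j).totalDegree ≤ n)
    (Ptop : AffMat n m) (htop : ∀ i j, Ptop i j = homogeneousComponent n ((A.adjugate * B) i j)) (k : ℕ) :
    homogeneousComponent (k * n) ((det ((Polynomial.X : Polynomial (MvPolynomial (Fin n × Fin n) ℂ)) •
        B.map Polynomial.C + A.map Polynomial.C)).coeff k) =
      MvPolynomial.C c * ((-((MvPolynomial.C c⁻¹ : MvPolynomial (Fin n × Fin n) ℂ) • Ptop)).charpolyRev).coeff k := by
  have hv : A.det * MvPolynomial.C c⁻¹ = 1 := by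
    rw [hdet, ← map_mul, mul_inv_cancel₀ hc, map_one]
  rw [det_X_smul_add_eq_C_mul_charpolyRev A B _ hv, Polynomial.coeff_C_mul, hdet, homogeneousComponent_C_mul]
  congr 1
  refine homogeneousComponent_coeff_charpolyRev_top n _ _ (fun i j => ?_) (fun i j => ?_) k
  · rw [Matrix.neg_apply, totalDegree_neg, Matrix.smul_apply, smul_eq_mul]
    exact (totalDegree_mul _ _).trans (by rw [totalDegree_C, zero_add]; exact hP i j)
  · rw [Matrix.neg_apply, Matrix.neg_apply, Matrix.smul_apply, Matrix.smul_apply, smul_eq_mul, smul_eq_mul, map_neg,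
      homogeneousComponent_C_mul, htop]

/-- `det(1 − M)` is the value of `det(1 − X·M)` at `X = 1`. [folklore] -/
theorem eval_one_charpolyRev {R : Type*} [CommRing R] {ι : Type*} [Fintype ι] [DecidableEq ι] (M : Matrix ι ι R) :
    (M.charpolyRev).eval 1 = det (1 - M) := by
  rw [Matrix.charpolyRev, ← Polynomial.coe_evalRingHom, RingHom.map_det]
  congr 1
  ext i j
  rw [RingHom.mapMatrix_apply, Matrix.map_apply, Matrix.sub_apply, Matrix.sub_apply, Matrix.smul_apply,
    Matrix.map_apply, smul_eq_mul, Polynomial.coe_evalRingHom, Polynomial.eval_sub, Polynomial.eval_mul,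
    Polynomial.eval_X, Polynomial.eval_C, one_mul, Matrix.one_apply, Matrix.one_apply]
  split_ifs <;> simp

/-- ★ **The shadow of a pencil with numerator of degree `≤ n` is an honest determinant**:
`Σ_{k ≤ m} [D_k]_{k·n} = c·det(1_m + c⁻¹·P^top)`. [folklore] -/
theorem sum_topCompanions_eq_det (A B : AffMat n m) (c : ℂ) (hc : c ≠ 0) (hdet : A.det = MvPolynomial.C c)
    (hP : ∀ i j, ((A.adjugate * B) i j).totalDegree ≤ n)
    (Ptop : AffMat n m) (htop : ∀ i j, Ptop i j = homogeneousComponent n ((A.adjugate * B) i j)) :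
    (∑ k ∈ Finset.range (m + 1), homogeneousComponent (k * n)
      ((det ((Polynomial.X : Polynomial (MvPolynomial (Fin n × Fin n) ℂ)) • B.map Polynomial.C +
        A.map Polynomial.C)).coeff k)) =
      MvPolynomial.C c * det (1 + (MvPolynomial.C c⁻¹ : MvPolynomial (Fin n × Fin n) ℂ) • Ptop) := by
  simp_rw [topCompanion_eq A B c hc hdet hP Ptop htop]
  rw [← Finset.mul_sum]
  congr 1
  set M := -((MvPolynomial.C c⁻¹ : MvPolynomial (Fin n × Fin n) ℂ) • Ptop) with hM
  have hdeg : (M.charpolyRev).natDegree < m + 1 := by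
    rw [← Matrix.reverse_charpoly]
    refine lt_of_le_of_lt (Polynomial.reverse_natDegree_le _) ?_
    nontriviality MvPolynomial (Fin n × Fin n) ℂ
    rw [Matrix.charpoly_natDegree_eq_dim, Fintype.card_fin]
    exact Nat.lt_succ_self m
  have h := Polynomial.eval_eq_sum_range' hdeg (1 : MvPolynomial (Fin n × Fin n) ℂ)
  simp_rw [one_pow, mul_one] at h
  rw [← h, eval_one_charpolyRev, hM, sub_neg_eq_add]

/-- **The shadow, explicitly** (`n ≥ 1`, `m ≥ 1`): with `per_n = α·det A + β·tr(adj A·B)`, `β ≠ 0`,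
`c + β⁻¹·per_n + Σ_{2 ≤ k ≤ m} [D_k]_{kn} = c·det(1_m + c⁻¹·P^top)`. [folklore] -/
theorem shadow_eq_det (hn : 1 ≤ n) (hm : 1 ≤ m) (A B : AffMat n m) (α β c : ℂ) (hc : c ≠ 0) (hβ : β ≠ 0)
    (hdet : A.det = MvPolynomial.C c)
    (hper : perPoly (Fin n) ℂ = MvPolynomial.C α * A.det + MvPolynomial.C β * (A.adjugate * B).trace)
    (hP : ∀ i j, ((A.adjugate * B) i j).totalDegree ≤ n)
    (Ptop : AffMat n m) (htop : ∀ i j, Ptop i j = homogeneousComponent n ((A.adjugate * B) i j))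
    (D : ℕ → MvPolynomial (Fin n × Fin n) ℂ)
    (hD : ∀ k, D k = (det ((Polynomial.X : Polynomial (MvPolynomial (Fin n × Fin n) ℂ)) •
      B.map Polynomial.C + A.map Polynomial.C)).coeff k) :
    MvPolynomial.C c + MvPolynomial.C β⁻¹ * perPoly (Fin n) ℂ +
        (∑ k ∈ Finset.range (m + 1), if 2 ≤ k then homogeneousComponent (k * n) (D k) else 0) =
      MvPolynomial.C c * det (1 + (MvPolynomial.C c⁻¹ : MvPolynomial (Fin n × Fin n) ℂ) • Ptop) := by
  classical
  rw [← sum_topCompanions_eq_det A B c hc hdet hP Ptop htop]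
  -- the terms `k = 0` and `k = 1`
  have h0 : homogeneousComponent (0 * n) (D 0) = MvPolynomial.C c := by
    rw [hD, coeff_det_zero, hdet, zero_mul, homogeneousComponent_zero, coeff_C, if_pos rfl]
  have hu : IsUnit A.det := by
    rw [hdet]; exact (isUnit_iff_ne_zero.mpr hc).map MvPolynomial.C
  have h1 : homogeneousComponent (1 * n) (D 1) = MvPolynomial.C β⁻¹ * perPoly (Fin n) ℂ := by
    have hhom : (perPoly (Fin n) ℂ).IsHomogeneous n := by
      simpa only [Fintype.card_fin] using (perPoly_isHomogeneous (n := Fin n) (k := ℂ))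
    rw [hD, coeff_det_one A B hu, one_mul, trace_adjugate_mul_eq_of_per A B α β c hβ hdet hper,
      homogeneousComponent_C_mul, map_sub,
      homogeneousComponent_of_mem ((mem_homogeneousSubmodule _ _).mpr hhom), if_pos rfl,
      homogeneousComponent_of_mem ((mem_homogeneousSubmodule _ _).mpr (isHomogeneous_C _ _)), if_neg (by omega),
      sub_zero]
  have hsplit : ∀ k, homogeneousComponent (k * n) (D k) =
      (if 2 ≤ k then homogeneousComponent (k * n) (D k) else 0) +
        ((if k = 0 then MvPolynomial.C c else 0) + (if k = 1 then MvPolynomial.C β⁻¹ * perPoly (Fin n) ℂ else 0)) := by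
    intro k
    rcases Nat.lt_or_ge k 2 with hk | hk
    · interval_cases k
      · rw [h0]; simp
      · rw [h1]; simp
    · rw [if_pos hk, if_neg (by omega), if_neg (by omega), add_zero, add_zero]
  simp_rw [← hD] at *
  rw [Finset.sum_congr rfl fun k _ => hsplit k, Finset.sum_add_distrib, Finset.sum_add_distrib,
    Finset.sum_ite_eq' (Finset.range (m + 1)) 0, Finset.sum_ite_eq' (Finset.range (m + 1)) 1,
    if_pos (Finset.mem_range.mpr (by omega)), if_pos (Finset.mem_range.mpr (by omega))]
  ring

end Shadow

end Summit.ValiantsHypothesis.ValiantsHypothesis.Theorems.GrenetZeonTwoDimCoefficients.ScalingClosure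

end
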